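import Summits.AtomisticToContinuum.Crystallization.Theorems.ChargedEnergyGapNeighbourhoodLedger
import HarnessLib

/-!
# `ChargedEnergyGap` — the REGULAR LEDGER: other gross charged sites leave both accounts
# (cell `decomp-a2c`, lens 3, generation 49, node «NeighbourhoodLedger», part L-D; over part L-C)

Under the guard `Guard ε s` (no rattlers, points pairwise `≥ s` apart) every site excess is TWO-SIDED BOUNDED a priori:
`−sepFloor s ≤ siteEnergy Q y − e* < (ε − e*)/2` (§1: the lower bound is packing of the `1`-ball plus the sharp sixth-power tail
of the periodic lattice sum — a genuine `tsum` bound via `summable_lennardJones_dist_three`; the upper bound is the no-rattler clause).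
Hence the terms of the OTHER GROSS CHARGED SITES THEMSELVES in the ball accounts and in the far account of part I-B are worth at
most a constant times the old self-weighted counts `ballOtherCount` / `farOtherCount`, which the neighbourhood debits of part L-C
dominate (`ballOtherCount_le_ballNearDebit`, `farOtherCount_le_farNearDebit`).  So both open localised ends may be stated on the
REGULAR accounts — the same weighted sums with every other-gross site's own term deleted — AT NO COST: ★★ `coreBallPricingG_iff_regular`,
`farFloorG_iff_regular` (exact, both directions, every `s > 0`, `ρ₀ ≥ 0`; the constants move by `sepFloor s` one way and by
`max 0 ((ε − e*)/2)` the other, inside the existential debit coefficients).  What BALL_G / FAR_G price is therefore ONLY regular matter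
(charge-free and charted sites) and the cores; gross non-core matter enters solely through the debits.  In the far account the cores'
own terms vanish too (`farWeight_eq_zero_of_isCore`), so REG-FAR_G speaks of charge-free and charted sites only: exactly the
Cauchy–Born content of memo g47 F6 / g49 §3 (ε), now isolated as a typed statement.

§1 `sepFloor`, ★ `neg_sepFloor_le_siteEnergy` (periodic, any `s`-separated `Q`, any point of space), the two-sided site-excess bounds
   under the guard.
§2 Regular / gross splits of the ball and far accounts (exact) and the a-priori bounds of the gross parts under the guard.
§3 THE REGULAR PIECES `CoreBallRegularPricingG … σ` (REG-BALL_G|σ), `FarRegularFloorG …` (REG-FAR_G) and ★★ the equivalences with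
   BALL_G|σ / FAR_G of part L-C.
§4 RECORD: `chargedEnergyGap_of_regularLedger_record` (seven leaves, BALL_G / FAR_G replaced by their regular twins) and the two
   record equivalences `coreBallPricingG_record_iff_regular`, `farFloorG_record_iff_regular`.

TAGS.  REG-BALL_G ⟺ BALL_G (UNDECIDED · INSTRUMENTABLE · IDEA-NEEDED), REG-FAR_G ⟺ FAR_G (TRUE-leaning · ATTACKABLE-L): EQUIV re-typings,
not new content; their use is that census accounts and the Cauchy–Born split of the g50 docket need not price gross matter at all.
All `[this work]` = cell decomp-a2c lens 3.
-/

noncomputable section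
open scoped Classical
open Filter Topology
open Literature.MathematicalPhysics.StatisticalMechanics
open Literature.Geometry.DiscreteGeometry
open Summit.AtomisticToContinuum.Crystallization.Theses.PricedLinkCensus
open Summit.AtomisticToContinuum.Crystallization.Theorems.ChargedEnergyGapNegative
open Summit.AtomisticToContinuum.Crystallization.Theorems.PerronTransitivityUniformBindingRigidity
  (sum_inv_pow_six_le_sharp)

namespace Summit.AtomisticToContinuum.Crystallization.Theorems.ChargedEnergyGapChartDial

/-! ## §1 Two-sided site energies under the guard -/

section SiteBounds

/-- The **separation floor**: half of (packing of the unit ball at separation `s`)/12 plus (the sharp sixth-power tail beyond `1`)/6. -/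
def sepFloor (s : ℝ) : ℝ :=
  2⁻¹ * ((2 / s + 1) ^ 3 / 12 + (16 / s ^ 3 + 18 / s ^ 2 + 36 / (5 * s) + 1) / 6)

/-- The separation floor is non-negative (`0 < s`). -/
theorem sepFloor_nonneg {s : ℝ} (hs : 0 < s) : 0 ≤ sepFloor s := by
  unfold sepFloor; positivity

/-- At the guard of record `s = 3/5`: `sepFloor (3/5) = 9599/648 ≈ 14.81 < 15` (so every guarded site excess is `> −15`). -/
theorem sepFloor_three_fifths_lt : sepFloor (3 / 5) < 15 := by
  unfold sepFloor; norm_num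

/-- ★ **A-priori lower bound of the periodic site energy under separation.**  If the points of `Q` are pairwise `≥ s > 0` apart, then
at EVERY point `x` of space: `−sepFloor s ≤ siteEnergy Q x` (each of the `≤ (2/s+1)³` points of `Q` within `1` of `x` contributes
`≥ −1/12`, the rest contribute `≥ −d⁻⁶/6`, summed by the sharp layer-cake tail; the lattice sum is a genuine sum,
`summable_lennardJones_dist_three`, so the bound passes to the limit of the finite partial sums). -/
theorem neg_sepFloor_le_siteEnergy {s : ℝ} (hs : 0 < s) {Q : PeriodicConfiguration 3}
    (hsep : ∀ p ∈ Q.points, ∀ q ∈ Q.points, p ≠ q → s ≤ dist p q) (x : E3) :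
    -sepFloor s ≤ siteEnergy Q x := by
  unfold siteEnergy
  set f : {y : E3 // y ∈ Q.points ∧ y ≠ x} → ℝ := fun y => lennardJones (dist x y.1) with hf
  have hsum : Summable f := Q.summable_lennardJones_dist_three x
  have key : ∀ u : Finset {y : E3 // y ∈ Q.points ∧ y ≠ x},
      -((2 / s + 1) ^ 3 / 12 + (16 / s ^ 3 + 18 / s ^ 2 + 36 / (5 * s) + 1) / 6) ≤ ∑ y ∈ u, f y := by
    intro u
    have hsplit := Finset.sum_filter_add_sum_filter_not u (fun y => dist x y.1 ≤ 1) f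
    have hnear : -((2 / s + 1) ^ 3 / 12) ≤ ∑ y ∈ u.filter (fun y => dist x y.1 ≤ 1), f y := by
      have h1 : ∑ y ∈ u.filter (fun y => dist x y.1 ≤ 1), (-1 / 12 : ℝ) ≤ ∑ y ∈ u.filter (fun y => dist x y.1 ≤ 1), f y :=
        Finset.sum_le_sum fun y _ => neg_one_div_le_lennardJones _
      have hcard := card_le_of_separated_of_dist_le ((u.filter fun y => dist x y.1 ≤ 1).image Subtype.val) x hs zero_le_one
        (fun c hc => by
          obtain ⟨y, hy, rfl⟩ := Finset.mem_image.1 hc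
          rw [dist_comm]; exact (Finset.mem_filter.1 hy).2)
        (fun c hc d hd hcd => by
          obtain ⟨y, -, rfl⟩ := Finset.mem_image.1 hc
          obtain ⟨y', -, rfl⟩ := Finset.mem_image.1 hd
          exact hsep _ y.2.1 _ y'.2.1 hcd)
      rw [finrank_euclideanSpace_fin, Finset.card_image_of_injective _ Subtype.val_injective, mul_one] at hcard
      rw [Finset.sum_const, nsmul_eq_mul] at h1
      linarith
    have hfar : -((16 / s ^ 3 + 18 / s ^ 2 + 36 / (5 * s) + 1) / 6) ≤ ∑ y ∈ u.filter (fun y => ¬ dist x y.1 ≤ 1), f y := by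
      have h1 : ∑ y ∈ u.filter (fun y => ¬ dist x y.1 ≤ 1), -(1 / 6 * (dist x y.1)⁻¹ ^ 6) ≤
          ∑ y ∈ u.filter (fun y => ¬ dist x y.1 ≤ 1), f y :=
        Finset.sum_le_sum fun y _ => Summit.AtomisticToContinuum.Crystallization.Theorems.OverbindingBudgetEnergyLayerTail.lennardJones_ge_neg _
      have hT := sum_inv_pow_six_le_sharp hs hsep x one_pos ((u.filter fun y => ¬ dist x y.1 ≤ 1).image Subtype.val)
        fun q hq => by
          obtain ⟨y, hy, rfl⟩ := Finset.mem_image.1 hq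
          refine ⟨y.2.1, ?_⟩
          rw [dist_comm]; exact (not_le.1 (Finset.mem_filter.1 hy).2).le
      rw [Finset.sum_image fun a _ b _ h => Subtype.ext h] at hT
      have hEq : ∑ y ∈ u.filter (fun y => ¬ dist x y.1 ≤ 1), -(1 / 6 * (dist x y.1)⁻¹ ^ 6) =
          -(1 / 6 * ∑ y ∈ u.filter (fun y => ¬ dist x y.1 ≤ 1), (dist (y.1) x)⁻¹ ^ 6) := by
        rw [Finset.mul_sum, ← Finset.sum_neg_distrib]
        exact Finset.sum_congr rfl fun y _ => by rw [dist_comm]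
      have hR : (16 / (s ^ 3 * 1 ^ 3) + 18 / (s ^ 2 * 1 ^ 4) + 36 / (5 * s * 1 ^ 5) + 1 / 1 ^ 6 : ℝ) =
          16 / s ^ 3 + 18 / s ^ 2 + 36 / (5 * s) + 1 := by ring
      linarith
    linarith
  have ht : Tendsto (fun u : Finset {y : E3 // y ∈ Q.points ∧ y ≠ x} => ∑ y ∈ u, f y) atTop (𝓝 (∑' y, f y)) := hsum.hasSum
  have hge := ge_of_tendsto' ht key
  unfold sepFloor
  linarith

variable {ε s : ℝ} {Q : PeriodicConfiguration 3}

/-- Under the guard every motif site's excess is `≥ −sepFloor s` (`0 < s`; uses `e* ≤ −1/10`). -/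
theorem neg_sepFloor_le_siteExcess_of_guard (hG : Guard ε s Q) (hs : 0 < s) (y : Q.motif) :
    -sepFloor s ≤ siteEnergy Q (y : E3) - eStar := by
  have h := neg_sepFloor_le_siteEnergy hs (fun p hp q hq hpq => hG.le_dist hp hq hpq) (y : E3)
  linarith [eStar_add_tenth_nonpos]

/-- Under the guard every motif site's excess is `< (ε − e*)/2` (no rattlers). -/
theorem siteExcess_lt_of_guard (hG : Guard ε s Q) (y : Q.motif) : siteEnergy Q (y : E3) - eStar < (ε - eStar) / 2 := by
  have h := not_le.1 (hG.not_rattler y)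
  linarith

/-- The non-negative **rattler cap** form of the upper bound. -/
theorem siteExcess_le_cap_of_guard (hG : Guard ε s Q) (y : Q.motif) : siteEnergy Q (y : E3) - eStar ≤ max 0 ((ε - eStar) / 2) :=
  (siteExcess_lt_of_guard hG y).le.trans (le_max_right _ _)

/-- Record form: under the guard of record `(ε, s) = (1/10, 3/5)` every site excess lies in `(−15, (1/10 − e*)/2)`. -/
theorem siteExcess_mem_Ioo_of_guard_record (hG : Guard (1 / 10) (3 / 5) Q) (y : Q.motif) :
    siteEnergy Q (y : E3) - eStar ∈ Set.Ioo (-15) ((1 / 10 - eStar) / 2) :=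
  ⟨by linarith [neg_sepFloor_le_siteExcess_of_guard hG (by norm_num) y, sepFloor_three_fifths_lt], siteExcess_lt_of_guard hG y⟩

end SiteBounds

/-! ## §2 Regular and gross parts of the accounts -/

section Split

variable (θ ε R r η L δ L' ϱ : ℝ)

/-- The **REGULAR BALL ACCOUNT** of `x`: the ball account with every other-gross site's own term deleted. -/
def ballRegularExcess (Q : PeriodicConfiguration 3) (x : Q.motif) : ℝ :=
  ∑ y : Q.motif, if IsOtherGross θ ε R r η L δ L' Q y then 0 else
    ballWeight θ ε R r η L δ L' ϱ Q x (y : E3) * (siteEnergy Q (y : E3) - eStar)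

/-- The **GROSS PART of the ball account** of `x`: the other-gross sites' own terms. -/
def ballGrossExcess (Q : PeriodicConfiguration 3) (x : Q.motif) : ℝ :=
  ∑ y : Q.motif, if IsOtherGross θ ε R r η L δ L' Q y then
    ballWeight θ ε R r η L δ L' ϱ Q x (y : E3) * (siteEnergy Q (y : E3) - eStar) else 0

/-- The **REGULAR FAR ACCOUNT**: the far account with every other-gross site's own term deleted. -/
def farRegularExcess (Q : PeriodicConfiguration 3) : ℝ :=
  ∑ y : Q.motif, if IsOtherGross θ ε R r η L δ L' Q y then 0 else
    farWeight θ ε R r η L δ L' ϱ Q (y : E3) * (siteEnergy Q (y : E3) - eStar)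

/-- The **GROSS PART of the far account**. -/
def farGrossExcess (Q : PeriodicConfiguration 3) : ℝ :=
  ∑ y : Q.motif, if IsOtherGross θ ε R r η L δ L' Q y then
    farWeight θ ε R r η L δ L' ϱ Q (y : E3) * (siteEnergy Q (y : E3) - eStar) else 0

variable {θ ε R r η L δ L' ϱ}

/-- The ball account is its regular part plus its gross part (exact). -/
theorem ballExcess_eq_regular_add_gross (Q : PeriodicConfiguration 3) (x : Q.motif) :
    ballExcess θ ε R r η L δ L' ϱ Q x = ballRegularExcess θ ε R r η L δ L' ϱ Q x + ballGrossExcess θ ε R r η L δ L' ϱ Q x := by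
  unfold ballExcess ballRegularExcess ballGrossExcess
  rw [← Finset.sum_add_distrib]
  exact Finset.sum_congr rfl fun y _ => by split_ifs <;> simp

/-- The far account is its regular part plus its gross part (exact). -/
theorem farExcess_eq_regular_add_gross (Q : PeriodicConfiguration 3) :
    farExcess θ ε R r η L δ L' ϱ Q = farRegularExcess θ ε R r η L δ L' ϱ Q + farGrossExcess θ ε R r η L δ L' ϱ Q := by
  unfold farExcess farRegularExcess farGrossExcess
  rw [← Finset.sum_add_distrib]
  exact Finset.sum_congr rfl fun y _ => by split_ifs <;> simp

/-- A core's own term is absent from the regular far account as well (`w` vanishes at cores): the regular far account is carried by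
the sites that are neither other-gross nor cores, i.e. by charge-free and charted matter only. -/
theorem farRegularExcess_eq_sum_plain (Q : PeriodicConfiguration 3) :
    farRegularExcess θ ε R r η L δ L' ϱ Q = ∑ y : Q.motif,
      if IsOtherGross θ ε R r η L δ L' Q y ∨ IsCore θ ε R r η L δ L' Q y then 0 else
        farWeight θ ε R r η L δ L' ϱ Q (y : E3) * (siteEnergy Q (y : E3) - eStar) := by
  unfold farRegularExcess
  refine Finset.sum_congr rfl fun y _ => ?_
  by_cases hg : IsOtherGross θ ε R r η L δ L' Q y
  · rw [if_pos hg, if_pos (Or.inl hg)]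
  · by_cases hc : IsCore θ ε R r η L δ L' Q y
    · rw [if_neg hg, if_pos (Or.inr hc), farWeight_eq_zero_of_isCore hc, zero_mul]
    · rw [if_neg hg, if_neg (not_or.2 ⟨hg, hc⟩)]

variable {s : ℝ}

/-- Under the guard the gross part of a ball account is `≥ −sepFloor s ·` the old self-weighted debit count. -/
theorem neg_mul_ballOtherCount_le_ballGrossExcess {Q : PeriodicConfiguration 3} (hG : Guard ε s Q) (hs : 0 < s) (x : Q.motif) :
    -(sepFloor s * ballOtherCount θ ε R r η L δ L' ϱ Q x) ≤ ballGrossExcess θ ε R r η L δ L' ϱ Q x := by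
  unfold ballOtherCount ballGrossExcess
  rw [Finset.mul_sum, ← Finset.sum_neg_distrib]
  refine Finset.sum_le_sum fun y _ => ?_
  by_cases hy : IsOtherGross θ ε R r η L δ L' Q y
  · rw [if_pos hy, if_pos hy]
    have h1 := neg_sepFloor_le_siteExcess_of_guard hG hs y
    have hw := ballWeight_nonneg (θ := θ) (ε := ε) (R := R) (r := r) (η := η) (L := L) (δ := δ) (L' := L') (ϱ := ϱ) Q x (y : E3)
    nlinarith
  · rw [if_neg hy, if_neg hy, mul_zero, neg_zero]

/-- Under the guard the gross part of a ball account is `≤ max 0 ((ε − e*)/2) ·` the old self-weighted debit count. -/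
theorem ballGrossExcess_le_cap_mul {Q : PeriodicConfiguration 3} (hG : Guard ε s Q) (x : Q.motif) :
    ballGrossExcess θ ε R r η L δ L' ϱ Q x ≤ max 0 ((ε - eStar) / 2) * ballOtherCount θ ε R r η L δ L' ϱ Q x := by
  unfold ballOtherCount ballGrossExcess
  rw [Finset.mul_sum]
  refine Finset.sum_le_sum fun y _ => ?_
  by_cases hy : IsOtherGross θ ε R r η L δ L' Q y
  · rw [if_pos hy, if_pos hy]
    have h1 := siteExcess_le_cap_of_guard hG y
    have hw := ballWeight_nonneg (θ := θ) (ε := ε) (R := R) (r := r) (η := η) (L := L) (δ := δ) (L' := L') (ϱ := ϱ) Q x (y : E3)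
    nlinarith
  · rw [if_neg hy, if_neg hy, mul_zero]

/-- Under the guard the gross part of the far account is `≥ −sepFloor s · farOtherCount`. -/
theorem neg_mul_farOtherCount_le_farGrossExcess {Q : PeriodicConfiguration 3} (hG : Guard ε s Q) (hs : 0 < s) :
    -(sepFloor s * farOtherCount θ ε R r η L δ L' ϱ Q) ≤ farGrossExcess θ ε R r η L δ L' ϱ Q := by
  unfold farOtherCount farGrossExcess
  rw [Finset.mul_sum, ← Finset.sum_neg_distrib]
  refine Finset.sum_le_sum fun y _ => ?_
  by_cases hy : IsOtherGross θ ε R r η L δ L' Q y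
  · rw [if_pos hy, if_pos hy]
    have h1 := neg_sepFloor_le_siteExcess_of_guard hG hs y
    have hw := farWeight_nonneg (θ := θ) (ε := ε) (R := R) (r := r) (η := η) (L := L) (δ := δ) (L' := L') (ϱ := ϱ) Q (y : E3)
    nlinarith
  · rw [if_neg hy, if_neg hy, mul_zero, neg_zero]

/-- Under the guard the gross part of the far account is `≤ max 0 ((ε − e*)/2) · farOtherCount`. -/
theorem farGrossExcess_le_cap_mul {Q : PeriodicConfiguration 3} (hG : Guard ε s Q) :
    farGrossExcess θ ε R r η L δ L' ϱ Q ≤ max 0 ((ε - eStar) / 2) * farOtherCount θ ε R r η L δ L' ϱ Q := by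
  unfold farOtherCount farGrossExcess
  rw [Finset.mul_sum]
  refine Finset.sum_le_sum fun y _ => ?_
  by_cases hy : IsOtherGross θ ε R r η L δ L' Q y
  · rw [if_pos hy, if_pos hy]
    have h1 := siteExcess_le_cap_of_guard hG y
    have hw := farWeight_nonneg (θ := θ) (ε := ε) (R := R) (r := r) (η := η) (L := L) (δ := δ) (L' := L') (ϱ := ϱ) Q (y : E3)
    nlinarith
  · rw [if_neg hy, if_neg hy, mul_zero]

end Split

/-! ## §3 The regular pieces and their equivalence with BALL_G / FAR_G -/

section Pieces

variable (θ ε R r η L δ L' ϱ c₁ s ρ₀ : ℝ)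

/-- piece REG-BALL_G|σ ⟺ BALL_G|σ (`coreBallPricingG_iff_regular`) · UNDECIDED · INSTRUMENTABLE · IDEA-NEEDED.  **GUARDED CORE BALL
PRICING ON THE REGULAR ACCOUNT**: as `CoreBallPricingG`, with every other-gross site's own term deleted from the account. -/
def CoreBallRegularPricingG (σ : ∀ Q : PeriodicConfiguration 3, Q.motif → Prop) : Prop :=
  ∃ κ₀ C₀ : ℝ, c₁ < κ₀ ∧ 0 ≤ C₀ ∧ ∀ Q : PeriodicConfiguration 3, Guard ε s Q → ∀ x : Q.motif, IsCore θ ε R r η L δ L' Q x →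
    σ Q x → κ₀ * ballCoreCount θ ε R r η L δ L' ϱ Q x - C₀ * ballNearDebit θ ε R r η L δ L' ϱ ρ₀ Q x ≤
      ballRegularExcess θ ε R r η L δ L' ϱ Q x

/-- piece REG-FAR_G ⟺ FAR_G (`farFloorG_iff_regular`) · TRUE-leaning · ATTACKABLE-L (Cauchy–Born pointwise on charge-free and charted
matter, memo g47 F6).  **GUARDED FAR FLOOR ON THE REGULAR ACCOUNT**: as `FarFloorG`, with every other-gross site's own term deleted. -/
def FarRegularFloorG : Prop :=
  ∃ C₁ : ℝ, 0 ≤ C₁ ∧ ∀ Q : PeriodicConfiguration 3, Guard ε s Q →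
    -(C₁ * farNearDebit θ ε R r η L δ L' ϱ ρ₀ Q) - c₁ * (motifCoreIncoherent θ ε R r η L δ L' Q : ℝ) ≤
      farRegularExcess θ ε R r η L δ L' ϱ Q

variable {θ ε R r η L δ L' ϱ c₁ s ρ₀}

/-- BALL_G|σ ⟹ REG-BALL_G|σ (`0 ≤ ρ₀`; debit coefficient `C₀ + max 0 ((ε − e*)/2)`: the deleted terms are capped above by the no-rattler
clause and their weights by the neighbourhood debit). -/
theorem coreBallRegularPricingG_of_coreBallPricingG {σ : ∀ Q : PeriodicConfiguration 3, Q.motif → Prop} (hρ : 0 ≤ ρ₀)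
    (h : CoreBallPricingG θ ε R r η L δ L' ϱ c₁ s ρ₀ σ) : CoreBallRegularPricingG θ ε R r η L δ L' ϱ c₁ s ρ₀ σ := by
  obtain ⟨κ₀, C₀, hκ, hC, hball⟩ := h
  refine ⟨κ₀, C₀ + max 0 ((ε - eStar) / 2), hκ, add_nonneg hC (le_max_left _ _), fun Q hQ x hx hσ => ?_⟩
  have h1 := hball Q hQ x hx hσ
  have h2 := ballExcess_eq_regular_add_gross (θ := θ) (ε := ε) (R := R) (r := r) (η := η) (L := L) (δ := δ) (L' := L') (ϱ := ϱ) Q x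
  have h3 := ballGrossExcess_le_cap_mul (θ := θ) (R := R) (r := r) (η := η) (L := L) (δ := δ) (L' := L') (ϱ := ϱ) hQ x
  have h4 := ballOtherCount_le_ballNearDebit (θ := θ) (ε := ε) (R := R) (r := r) (η := η) (L := L) (δ := δ) (L' := L') (ϱ := ϱ) hρ Q x
  have h5 : max 0 ((ε - eStar) / 2) * ballOtherCount θ ε R r η L δ L' ϱ Q x ≤
      max 0 ((ε - eStar) / 2) * ballNearDebit θ ε R r η L δ L' ϱ ρ₀ Q x := mul_le_mul_of_nonneg_left h4 (le_max_left _ _)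
  rw [add_mul]
  linarith

/-- REG-BALL_G|σ ⟹ BALL_G|σ (`0 < s`, `0 ≤ ρ₀`; debit coefficient `C₀ + sepFloor s`: the re-inserted terms are bounded below a priori). -/
theorem coreBallPricingG_of_regular {σ : ∀ Q : PeriodicConfiguration 3, Q.motif → Prop} (hs : 0 < s) (hρ : 0 ≤ ρ₀)
    (h : CoreBallRegularPricingG θ ε R r η L δ L' ϱ c₁ s ρ₀ σ) : CoreBallPricingG θ ε R r η L δ L' ϱ c₁ s ρ₀ σ := by
  obtain ⟨κ₀, C₀, hκ, hC, hball⟩ := h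
  refine ⟨κ₀, C₀ + sepFloor s, hκ, add_nonneg hC (sepFloor_nonneg hs), fun Q hQ x hx hσ => ?_⟩
  have h1 := hball Q hQ x hx hσ
  have h2 := ballExcess_eq_regular_add_gross (θ := θ) (ε := ε) (R := R) (r := r) (η := η) (L := L) (δ := δ) (L' := L') (ϱ := ϱ) Q x
  have h3 := neg_mul_ballOtherCount_le_ballGrossExcess (θ := θ) (R := R) (r := r) (η := η) (L := L) (δ := δ) (L' := L') (ϱ := ϱ) hQ hs x
  have h4 := ballOtherCount_le_ballNearDebit (θ := θ) (ε := ε) (R := R) (r := r) (η := η) (L := L) (δ := δ) (L' := L') (ϱ := ϱ) hρ Q x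
  have h5 : sepFloor s * ballOtherCount θ ε R r η L δ L' ϱ Q x ≤ sepFloor s * ballNearDebit θ ε R r η L δ L' ϱ ρ₀ Q x :=
    mul_le_mul_of_nonneg_left h4 (sepFloor_nonneg hs)
  rw [add_mul]
  linarith

/-- ★★ **BALL_G|σ ⟺ REG-BALL_G|σ** (`0 < s`, `0 ≤ ρ₀`): other gross charged sites leave the ball accounts at no cost. -/
theorem coreBallPricingG_iff_regular {σ : ∀ Q : PeriodicConfiguration 3, Q.motif → Prop} (hs : 0 < s) (hρ : 0 ≤ ρ₀) :
    CoreBallPricingG θ ε R r η L δ L' ϱ c₁ s ρ₀ σ ↔ CoreBallRegularPricingG θ ε R r η L δ L' ϱ c₁ s ρ₀ σ :=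
  ⟨coreBallRegularPricingG_of_coreBallPricingG hρ, coreBallPricingG_of_regular hs hρ⟩

/-- FAR_G ⟹ REG-FAR_G (`0 ≤ ρ₀`; coefficient `C₁ + max 0 ((ε − e*)/2)`). -/
theorem farRegularFloorG_of_farFloorG (hρ : 0 ≤ ρ₀) (h : FarFloorG θ ε R r η L δ L' ϱ c₁ s ρ₀) :
    FarRegularFloorG θ ε R r η L δ L' ϱ c₁ s ρ₀ := by
  obtain ⟨C₁, hC, hfar⟩ := h
  refine ⟨C₁ + max 0 ((ε - eStar) / 2), add_nonneg hC (le_max_left _ _), fun Q hQ => ?_⟩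
  have h1 := hfar Q hQ
  have h2 := farExcess_eq_regular_add_gross (θ := θ) (ε := ε) (R := R) (r := r) (η := η) (L := L) (δ := δ) (L' := L') (ϱ := ϱ) Q
  have h3 := farGrossExcess_le_cap_mul (θ := θ) (R := R) (r := r) (η := η) (L := L) (δ := δ) (L' := L') (ϱ := ϱ) hQ
  have h4 := farOtherCount_le_farNearDebit (θ := θ) (ε := ε) (R := R) (r := r) (η := η) (L := L) (δ := δ) (L' := L') (ϱ := ϱ) hρ Q
  have h5 : max 0 ((ε - eStar) / 2) * farOtherCount θ ε R r η L δ L' ϱ Q ≤ max 0 ((ε - eStar) / 2) * farNearDebit θ ε R r η L δ L' ϱ ρ₀ Q :=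
    mul_le_mul_of_nonneg_left h4 (le_max_left _ _)
  rw [add_mul]
  linarith

/-- REG-FAR_G ⟹ FAR_G (`0 < s`, `0 ≤ ρ₀`; coefficient `C₁ + sepFloor s`). -/
theorem farFloorG_of_regular (hs : 0 < s) (hρ : 0 ≤ ρ₀) (h : FarRegularFloorG θ ε R r η L δ L' ϱ c₁ s ρ₀) :
    FarFloorG θ ε R r η L δ L' ϱ c₁ s ρ₀ := by
  obtain ⟨C₁, hC, hfar⟩ := h
  refine ⟨C₁ + sepFloor s, add_nonneg hC (sepFloor_nonneg hs), fun Q hQ => ?_⟩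
  have h1 := hfar Q hQ
  have h2 := farExcess_eq_regular_add_gross (θ := θ) (ε := ε) (R := R) (r := r) (η := η) (L := L) (δ := δ) (L' := L') (ϱ := ϱ) Q
  have h3 := neg_mul_farOtherCount_le_farGrossExcess (θ := θ) (R := R) (r := r) (η := η) (L := L) (δ := δ) (L' := L') (ϱ := ϱ) hQ hs
  have h4 := farOtherCount_le_farNearDebit (θ := θ) (ε := ε) (R := R) (r := r) (η := η) (L := L) (δ := δ) (L' := L') (ϱ := ϱ) hρ Q
  have h5 : sepFloor s * farOtherCount θ ε R r η L δ L' ϱ Q ≤ sepFloor s * farNearDebit θ ε R r η L δ L' ϱ ρ₀ Q :=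
    mul_le_mul_of_nonneg_left h4 (sepFloor_nonneg hs)
  rw [add_mul]
  linarith

/-- ★★ **FAR_G ⟺ REG-FAR_G** (`0 < s`, `0 ≤ ρ₀`): other gross charged sites (and cores) leave the far account at no cost — what FAR_G
prices is charge-free and charted matter only. -/
theorem farFloorG_iff_regular (hs : 0 < s) (hρ : 0 ≤ ρ₀) :
    FarFloorG θ ε R r η L δ L' ϱ c₁ s ρ₀ ↔ FarRegularFloorG θ ε R r η L δ L' ϱ c₁ s ρ₀ :=
  ⟨farRegularFloorG_of_farFloorG hρ, farFloorG_of_regular hs hρ⟩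

end Pieces

/-! ## §4 The record `(…, ϱ, c₁, s, ρ₀) = (…, 160, 1/20, 3/5, 10)` on the regular accounts -/

section Record

/-- BALL_G of record ⟺ REG-BALL_G of record. -/
theorem coreBallPricingG_record_iff_regular :
    CoreBallPricingG (3 / 20) (1 / 10) (6 / 5) 10 (1 / 100) 40 (1 / 10) 40 160 (1 / 20) (3 / 5) 10 (fun _ _ => True) ↔
      CoreBallRegularPricingG (3 / 20) (1 / 10) (6 / 5) 10 (1 / 100) 40 (1 / 10) 40 160 (1 / 20) (3 / 5) 10 fun _ _ => True :=
  coreBallPricingG_iff_regular (by norm_num) (by norm_num)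

/-- FAR_G of record ⟺ REG-FAR_G of record. -/
theorem farFloorG_record_iff_regular :
    FarFloorG (3 / 20) (1 / 10) (6 / 5) 10 (1 / 100) 40 (1 / 10) 40 160 (1 / 20) (3 / 5) 10 ↔
      FarRegularFloorG (3 / 20) (1 / 10) (6 / 5) 10 (1 / 100) 40 (1 / 10) 40 160 (1 / 20) (3 / 5) 10 :=
  farFloorG_iff_regular (by norm_num) (by norm_num)

/-- ★★ **RECORD CONE ON THE REGULAR ACCOUNTS**, seven named leaves: `ChargeRecount · IP_G · FCP_G · CCP_G · REG-BALL_G · REG-FAR_G · P_G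
⟹ ChargedEnergyGap` at `(θ, ε, R, r, η, L, δ, L', ϱ, c₁, s, ρ₀) = (3/20, 1/10, 6/5, 10, 1/100, 40, 1/10, 40, 160, 1/20, 3/5, 10)`. -/
theorem chargedEnergyGap_of_regularLedger_record (hF : ChargeRecount)
    (hIP : ImprovablePricingG (3 / 20) (1 / 10) (6 / 5) 10 (1 / 100) (3 / 5))
    (hFCP : FrustratedCorePricingG (3 / 20) (1 / 10) (6 / 5) 10 (1 / 100) 40 (3 / 5))
    (hCCP : CoherentCorePricingG (3 / 20) (1 / 10) (6 / 5) 10 (1 / 100) 40 (1 / 10) 40 (3 / 5))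
    (hB : CoreBallRegularPricingG (3 / 20) (1 / 10) (6 / 5) 10 (1 / 100) 40 (1 / 10) 40 160 (1 / 20) (3 / 5) 10 fun _ _ => True)
    (hFar : FarRegularFloorG (3 / 20) (1 / 10) (6 / 5) 10 (1 / 100) 40 (1 / 10) 40 160 (1 / 20) (3 / 5) 10)
    (hP : ChartedChargePricingG (3 / 20) (1 / 10) (3 / 5)) : ChargedEnergyGap :=
  chargedEnergyGap_of_neighbourhoodLedger_record hF hIP hFCP hCCP (coreBallPricingG_record_iff_regular.2 hB)
    (farFloorG_record_iff_regular.2 hFar) hP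

end Record

end Summit.AtomisticToContinuum.Crystallization.Theorems.ChargedEnergyGapChartDial

end
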